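import Summits.QuantumFields.QCD.Theses.NestedDissectionSea
import Summits.QuantumFields.QCD.Theorems.NestedDissectionSeaCoerciveSeaSheetPileup
import Summits.QuantumFields.QCD.Theorems.NestedDissectionSeaCoerciveSeaCensusDominates
import Summits.QuantumFields.QCD.Theorems.NestedDissectionSeaCoerciveSeaSmallBoxes
import Summits.QuantumFields.QCD.Theorems.NestedDissectionSeaCoerciveSeaWindowShrink

/-!
# Line `chirality-collapses-pseudospectrum` — skeleton v10-c4 (lead c4, 2026-08-16T15:40Z) for the crux `CoerciveSea` (stmt-QuantumFields-13901)

Route `NestedDissectionSea`, crux `Summit.QuantumFields.QCD.Theses.NestedDissectionSea.CoerciveSea` (the hinge):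
`∀ N_f ∈ {2,3} ∃ reg (HasMassScaling, HasAsymptoticScaling) ∃ M₀ b₀ ℓ ∀ m > M₀ ∃ R` with (i) SEPARATOR WEGNER LAW IN
THE WINDOW `P_pq(HasSingularSeparator U m_f(k) s (t/s₀)) ≤ C t^α`, (ii) WINDOWED LOCAL DILUTION, (iii) PARITY PIN.

## v10-c4 = v9-c3 published: the composition is IMPORTED, not copied

History: v2 (planner, 5 stubs) → v3 (lead-0: stubs 1 `stub_sheetPileupOfSingularSeparator` p86787 and 2
`stub_censusDominates` p86451 LANDED) → v4-c1…v6-c1 (lead c1: physical-branch import, laws only on LARGE boxes, small boxes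
discharged by the landed `smallBox_separatorLaw` p97150) → v7-c2 → v8-c2 (lead c2: COARSENED to one open law
`stub_separatorLawLarge`, see `FINDINGS-lead-c2.md`) → v9-c3 (lead c3: glue `dilution_windowShrink` p107259 imported; THE
COMPOSITION landed as the hypotheses-theorem `coerciveSea_of_pinnedDilutionOnBranch_of_separatorLawLarge`, p108820, in
`Theorems/NestedDissectionSeaCoerciveSeaWindowShrink.lean`; v9 stayed evidence-only because the farm had no olean of the
appended module at 14:33Z) → v10-c4 (this file): identical stub set to v9, `CoerciveSea_of` is the one-line application of
the landed composition to the two registered stubs. Sorries: exactly two, both the content of EXISTING items —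
`stub_pinnedDilutionOnPhysicalBranch` (= item 13900 + the physical-branch conjunct `mcrit k → 0`; external, never briefed)
and `stub_separatorLawLarge` (= item 14759 read on the physical branch, off the small boxes; the lead's).

WHY ONE LAW (lead c2, kept by c3 and c4). The v4–v7 split of the sheet-weighted low-mode census by a chirality cut `χ₀`
(A″ chiral / B″ achiral) is idle for provability (neither half reduces to an existing item; massive sea modes are chiral,
`χ = m/E`; the cut sorts lumps by `λ₀/m_f`, not by mechanism) and by the landed stubs 1–2 the two halves imply exactly
clause (i) on large boxes (`separatorLawLarge_of_pileupLaws` below, sorry-free) — so the weakest sufficient open statement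
is registered directly.

WHAT THE OPEN LAW IS (leads c3/c4, `FINDINGS-lead-c3.md` §1–§5, `FINDINGS-lead-c4.md`). For an invertible cell the event
is EXACTLY a large value of the cell PROPAGATOR compressed to the internal separator: `HasSingularSeparator U μ s τ ↔
‖(D_c(μ)⁻¹)_ΣΣ‖ > 1/τ` (lead c4, LANDED p110101 `Theorems/NestedDissectionSeaCoerciveSeaPropagatorForm.lean`), and the
LANDED reduction `separatorLawLarge_of_propagatorLaw` (p111601, `Theorems/NestedDissectionSeaCoerciveSeaPropagatorLaw.lean`)
shows that the `k`-UNIFORM weak-type (Wegner) estimate `P_pq(det D_c(m_f(k)) = 0 ∨ ‖1_Σ D_c(m_f(k))⁻¹ 1_Σ‖ > s₀/t) ≤ C t^α`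
(same quantifier shell) implies `stub_separatorLawLarge` VERBATIM. That propagator law — for near-critical Dirichlet
Wilson–Dirac cells under the interacting phase-quenched `SU(3)` measure, the surface-compressed Green's function that
multiscale analysis propagates (Fröhlich–Spencer) and fractional-moment methods bound (Aizenman–Molchanov), here for a
gauge-covariant hopping disorder under a Gibbs (non-product) law, uniformly along a continuum limit where the plaquette law
concentrates (the regime every random-flux Wegner estimate in print excludes: Erdős–Hasler 2012 Thm 1, KNNN 2003, Ueki) — is
the research content. Heuristically TRUE with α = 1 and a constant that vanishes along the physical branch (near-resonant
carriers at resolution `t a_k²/ℓ'²` are mesoscopic lumps of size `≲ ρ_* ∝ a_k^{1/2}`, a population dying like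
`a_k^{(b−4)/2}`); no tree tool or published estimate reaches it. [difficulty: open-problem, research-grade]

## Composition (PROVED and LANDED): `CoerciveSea_of` = `coerciveSea_of_pinnedDilutionOnBranch_of_separatorLawLarge`
applied to the two stubs. Witness: `reg, M₁, b₀, ℓ'`; per mass tuple `R = max (max R₀ (ℓ + 1)) Rᴸ`, `α = αᴸ`,
`C = Cᴸ + κ₀^{−α}`, `κ₀ = 4(1 − cos(π/2S₁))`, `S₁ = max 1 S₀ᴸ`; small boxes by `smallBox_separatorLaw`, clause (ii) shrunk
to `ℓ'` by `dilution_windowShrink`, clause (iii) imported.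

## Disproof used (`Cruxes/CoerciveSea/Disproof.lean` v4, cycles 1–2, NO KILL; no `-- Targets` section names a stub of
this line; re-read 2026-08-16T14:45Z by lead c4, unchanged since 06:03Z). Part A/E (pin window, `limsup mcrit ≤ 0`,
`a_k/Z_m → 0`): why the branch clause is needed and why every fixed-level CELL statistic is junk. Part C (without the pin
the crux is junk-true): honoured — (ii),(iii) stay inside the import under the same `∃ reg`. Part F (valence offset
invisible at resolution `1/s`): the law resolves `a_k²`, finer than any valence line. Part D (fixed-`k` Łojasiewicz,
uniformity is the content): the registered law is exactly that uniformity statement, on large boxes only.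
-/

noncomputable section

open scoped BigOperators Classical
open MeasureTheory Filter Matrix
open Literature.MathematicalPhysics.QuantumLattice Literature.MathematicalPhysics.QuantumFieldTheory
  Literature.Probability.LatticeModels

namespace Summit.QuantumFields.QCD.Cruxes.CoerciveSea.ChiralityCollapsesPseudospectrum

/-! ## Registered stubs (`sorry` lives only here; signatures over tree vocabulary only) -/

/-- **Stub 3′ — `pinnedDilutionOnPhysicalBranch` (IMPORT: the rank-2 crux `NegativeCellsDilute` (stmt-13900) WITH
the physical-branch clause `mcrit k → 0` for the same witness; open, size XL, external — NOT this line's work; never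
brief a worker for it).** For `N_f ∈ {2,3}` there is ONE mass-independent regularisation with `HasMassScaling`,
`HasAsymptoticScaling` AND critical bare mass tending to `0` in lattice units (the physical branch: the additive mass
renormalisation of Wilson fermions is `m_c = −g₀²Σ₁ + O(g₀⁴) → 0` along an asymptotically free trajectory; the doubler
branches `mcrit → −2, −4, −6, −8`, which the pin alone does not exclude, are NOT wanted), `M₀ ≥ 0`, `b₀ ≥ 2`, `ℓ > 0`,
such that every mass tuple `m > M₀` has a physical size `R > 0` with (ii) WINDOWED LOCAL DILUTION and (iii) the
PARITY PIN — both VERBATIM the clauses of `NegativeCellsDilute` / `CoerciveSea`. Forgetting the clause gives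
`NegativeCellsDilute` (landed `negativeCellsDilute_of_pinnedDilutionOnBranch`, p108820); the converse is NOT formal (item 13900 as
filed lets its witness sit on a doubler branch) — planner action recorded in `FINDINGS-lead-c1.md`: restate 13900 with
the clause (costless for its lines) or file `NegativeCellsDilute ∧ physical branch` as the support this stub names.
Why it might fail: as 13900 (pair-collision carriers, Aoki-type band vs the valence offset; pin band). [difficulty:
open-problem, = stmt-13900 + branch clause] -/
theorem stub_pinnedDilutionOnPhysicalBranch :
    ∀ Nf : ℕ, (Nf = 2 ∨ Nf = 3) → ∃ reg : QCDRegularisation Nf, reg.HasMassScaling ∧ (reg.scheme 0 0 0).HasAsymptoticScaling ∧ Filter.Tendsto reg.mcrit Filter.atTop (nhds 0) ∧ ∃ M₀ : ℝ, 0 ≤ M₀ ∧ ∃ b₀ : ℕ, 2 ≤ b₀ ∧ ∃ ℓ : ℝ, 0 < ℓ ∧ ∀ m : Fin Nf → ℝ, (∀ f, M₀ < m f) → ∃ R : ℝ, 0 < R ∧ (∀ ε : ℝ, 0 < ε → ∀ᶠ k : ℕ in Filter.atTop, ∀ S : ℕ, R ≤ reg.a k * (2 * S + 1) → let N : ℕ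 := 2 * S + 1; let mq : Fin Nf → ℝ := fun f => reg.mcrit k + reg.a k * m f / reg.Zm k; let wt : GaugeConfig 4 N (Matrix.specialUnitaryGroup (Fin 3) ℂ) → ℝ := fun U => ∏ f, ‖fermionDet (wilsonDirac (fundamentalRep (Fin 3)) U (mq f) 1)‖; let P : (GaugeConfig 4 N (Matrix.specialUnitaryGroup (Fin 3) ℂ) → Prop) → ℝ := fun E => (∫ U, (if E U then (1 : ℝ) else 0) * wt U ∂(wilsonMeasure (d := 4) (L := N) (fundamentalRep (Fin 3)) (reg.β k))) / (∫ U, wt U ∂(wilsonMeasure (d := 4) (L := N) (fundamentalRep (Fin 3)) (reg.β k))); let J : ℕ := Nat.log 2 (⌊ℓ / reg.a k⌋₊ / b₀) + 1; ∃ δ : ℕ → ℝ, ∑ j ∈ Finset.range J, δ j ≤ ε ∧ ∀ j < J, ∀ s : Fin 4 → ℕ, (∀ i, b₀ * 2 ^ j ≤ s i ∧ s i < b₀ * 2 ^ (j + 2) ∧ s i ≤ N ∧ (s i : ℝ) * reg.a k ≤ ℓ) → P (fun U => ∃ f, IsSignDefect U (mq f) j s) ≤ δ j) ∧ (∀ M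 : ℝ, M₀ < M → ∀ᶠ k : ℕ in Filter.atTop, ∀ S : ℕ, R ≤ reg.a k * (2 * S + 1) → let N : ℕ := 2 * S + 1; let mq : Fin Nf → ℝ := fun f => reg.mcrit k + reg.a k * m f / reg.Zm k; let wt : GaugeConfig 4 N (Matrix.specialUnitaryGroup (Fin 3) ℂ) → ℝ := fun U => ∏ f, ‖fermionDet (wilsonDirac (fundamentalRep (Fin 3)) U (mq f) 1)‖; (1 / 4 : ℝ) ≤ (∫ U, (if (fermionDet (wilsonDirac (fundamentalRep (Fin 3)) U (reg.mcrit k - reg.a k * M / reg.Zm k) 1)).re < 0 then (1 : ℝ) else 0) * wt U ∂(wilsonMeasure (d := 4) (L := N) (fundamentalRep (Fin 3)) (reg.β k))) / (∫ U, wt U ∂(wilsonMeasure (d := 4) (L := N) (fundamentalRep (Fin 3)) (reg.β k)))) := by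
  sorry

/-- **Stub L — `separatorLawLarge` (CLAUSE (i) ON LARGE WINDOW BOXES ALONG THE PHYSICAL BRANCH; open, crux-sized —
THE open stub of v8, held by the lead).** For `N_f ∈ {2,3}` and every regularisation `reg` with `HasMassScaling`,
`HasAsymptoticScaling`, on the physical branch (`mcrit k → 0`), every `M₀ ≥ 0`, `b₀ ≥ 2`, `ℓ > 0` carrying the body of
`NegativeCellsDilute` (pinned, window-dilute; hypothesis verbatim): there are a valence threshold `M₁ ≥ M₀` and a
sub-window `ℓ' ∈ (0, ℓ]` such that for every `m > M₁` there are `R > 0`, a minimal side `S₀`, and `C, α > 0` with,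
eventually in `k`, on every odd torus of physical side `≥ R`, for every roughly cubic corner-`0` box with
`b₀ ≤ s_i ≤ N`, `s_i a_k ≤ ℓ'`, ALL SIDES `≥ S₀`, every flavour and every `t ∈ (0,1]`:
`P_pq(HasSingularSeparator U m_f(k) s (t/s₀)) ≤ C t^α` — the crux's own event and ratio, verbatim.
Sufficient: the v7 laws A″ ∧ B″ (`separatorLawLarge_of_pileupLaws`, sorry-free below). Content: a `k`-UNIFORM Wegner law
for the Schur separator of Dirichlet Wilson cells at the critical line (at fixed `k` it holds by Łojasiewicz with
`k`-dependent constants, uniformly in the volume — Disproof Part D; the uniformity in `k` across the window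
`S₀ ≤ s ≤ ℓ'/a_k` is the whole open problem: route text "SmallFieldSeparatorGap → LumpLifting → (i)", i.e. a Bałaban
small/large-field decomposition of the phase-quenched SU(3) measure up to the window scale plus the UV-convergent end of
the instanton measure). Why it might fail: a density `≳ a_k³ s/ℓ³` per site per unit bare mass of sheet-trapped
near-real cell modes at the valence line (Golterman–Shamir localised modes outside the Aoki phase; pair-born real modes
with an Aoki-type band `∝ a`). Leans on: `QCDRegularisation`, `wilsonMeasure`, `HasSingularSeparator`, `IsSignDefect`,
`fermionDet`, `wilsonDirac`; literature Balaban1988Convergent, Balaban1989LargeFieldII, tHooft1976, Luscher1982Topology,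
GiustiLuscher2009 (arXiv:0812.3638), GoltermanShamir2003, MohlerSchaefer2020, Wegner1981DensityOfStates — unproved physics
inputs. [difficulty: open-problem, crux-sized; = content of CoerciveOfDilute (stmt-14759) on the physical branch] -/
theorem stub_separatorLawLarge :
    ∀ (Nf : ℕ) (reg : QCDRegularisation Nf), (Nf = 2 ∨ Nf = 3) → reg.HasMassScaling → (reg.scheme 0 0 0).HasAsymptoticScaling → Filter.Tendsto reg.mcrit Filter.atTop (nhds 0) → ∀ M₀ : ℝ, 0 ≤ M₀ → ∀ b₀ : ℕ, 2 ≤ b₀ → ∀ ℓ : ℝ, 0 < ℓ → (∀ m : Fin Nf → ℝ, (∀ f, M₀ < m f) → ∃ R : ℝ, 0 < R ∧ (∀ ε : ℝ, 0 < ε → ∀ᶠ k : ℕ in Filter.atTop, ∀ S : ℕ, R ≤ reg.a k * (2 * S + 1) → let N : ℕ := 2 * S + 1; let mq : Fin Nf → ℝ := fun f => reg.mcrit k + reg.a k * m f / reg.Zm k; let wt : GaugeConfig 4 N (Matrix.specialUnitaryGroup (Fin 3) ℂ) → ℝ := fun U => ∏ f, ‖fermionDet (wilsonDirac (fundamentalRep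 (Fin 3)) U (mq f) 1)‖; let P : (GaugeConfig 4 N (Matrix.specialUnitaryGroup (Fin 3) ℂ) → Prop) → ℝ := fun E => (∫ U, (if E U then (1 : ℝ) else 0) * wt U ∂(wilsonMeasure (d := 4) (L := N) (fundamentalRep (Fin 3)) (reg.β k))) / (∫ U, wt U ∂(wilsonMeasure (d := 4) (L := N) (fundamentalRep (Fin 3)) (reg.β k))); let J : ℕ := Nat.log 2 (⌊ℓ / reg.a k⌋₊ / b₀) + 1; ∃ δ : ℕ → ℝ, ∑ j ∈ Finset.range J, δ j ≤ ε ∧ ∀ j < J, ∀ s : Fin 4 → ℕ, (∀ i, b₀ * 2 ^ j ≤ s i ∧ s i < b₀ * 2 ^ (j + 2) ∧ s i ≤ N ∧ (s i : ℝ) * reg.a k ≤ ℓ) → P (fun U => ∃ f, IsSignDefect U (mq f) j s) ≤ δ j) ∧ (∀ M : ℝ, M₀ < M → ∀ᶠ k : ℕ in Filter.atTop, ∀ S : ℕ, R ≤ reg.a k * (2 * S + 1) → let N : ℕ := 2 * S + 1; let mq : Fin Nf → ℝ := fun f => reg.mcrit k + reg.a k * m f / reg.Zm k; let wt : GaugeConfig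 4 N (Matrix.specialUnitaryGroup (Fin 3) ℂ) → ℝ := fun U => ∏ f, ‖fermionDet (wilsonDirac (fundamentalRep (Fin 3)) U (mq f) 1)‖; (1 / 4 : ℝ) ≤ (∫ U, (if (fermionDet (wilsonDirac (fundamentalRep (Fin 3)) U (reg.mcrit k - reg.a k * M / reg.Zm k) 1)).re < 0 then (1 : ℝ) else 0) * wt U ∂(wilsonMeasure (d := 4) (L := N) (fundamentalRep (Fin 3)) (reg.β k))) / (∫ U, wt U ∂(wilsonMeasure (d := 4) (L := N) (fundamentalRep (Fin 3)) (reg.β k))))) → ∃ M₁ : ℝ, M₀ ≤ M₁ ∧ ∃ ℓ' : ℝ, 0 < ℓ' ∧ ℓ' ≤ ℓ ∧ ∀ m : Fin Nf → ℝ, (∀ f, M₁ < m f) → ∃ R : ℝ, 0 < R ∧ ∃ S₀ : ℕ, ∃ C : ℝ, 0 < C ∧ ∃ α : ℝ, 0 < α ∧ ∀ᶠ k : ℕ in Filter.atTop, ∀ S : ℕ, R ≤ reg.a k * (2 * S + 1) → let N : ℕ := 2 * S + 1; let mq : Fin Nf → ℝ := fun f => reg.mcrit k + reg.a k * m f / reg.Zm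 k; let wt : GaugeConfig 4 N (Matrix.specialUnitaryGroup (Fin 3) ℂ) → ℝ := fun U => ∏ f, ‖fermionDet (wilsonDirac (fundamentalRep (Fin 3)) U (mq f) 1)‖; let P : (GaugeConfig 4 N (Matrix.specialUnitaryGroup (Fin 3) ℂ) → Prop) → ℝ := fun E => (∫ U, (if E U then (1 : ℝ) else 0) * wt U ∂(wilsonMeasure (d := 4) (L := N) (fundamentalRep (Fin 3)) (reg.β k))) / (∫ U, wt U ∂(wilsonMeasure (d := 4) (L := N) (fundamentalRep (Fin 3)) (reg.β k))); ∀ s : Fin 4 → ℕ, (∀ i, b₀ ≤ s i ∧ s i ≤ N ∧ (s i : ℝ) * reg.a k ≤ ℓ') → (∀ i, S₀ ≤ s i) → (∀ i j, s i ≤ 2 * s j) → ∀ f : Fin Nf, ∀ t : ℝ, 0 < t → t ≤ 1 → P (fun U => HasSingularSeparator U (mq f) s (t / s 0)) ≤ C * t ^ α := by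
  sorry

/-! ## Small sorry-free helpers (v7 ⇒ v8: nothing of the chirality split is lost) -/

/-- On `(0,1]`, lowering the exponent raises the power: `t ^ a ≤ t ^ min a b`, `t ^ b ≤ t ^ min a b`. -/
theorem rpow_le_rpow_min {t a b : ℝ} (ht0 : 0 < t) (ht1 : t ≤ 1) :
    t ^ a ≤ t ^ min a b ∧ t ^ b ≤ t ^ min a b :=
  ⟨Real.rpow_le_rpow_of_exponent_ge ht0 ht1 (min_le_left a b),
   Real.rpow_le_rpow_of_exponent_ge ht0 ht1 (min_le_right a b)⟩

/-- Combining two power laws on `(0,1]`: `C₁ t^α₁ + C₂ t^α₂ ≤ (C₁ + C₂) t^(min α₁ α₂)` for `C₁, C₂ ≥ 0`. -/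
theorem add_powerLaw_le {t C₁ C₂ α₁ α₂ : ℝ} (ht0 : 0 < t) (ht1 : t ≤ 1) (hC₁ : 0 ≤ C₁) (hC₂ : 0 ≤ C₂) :
    C₁ * t ^ α₁ + C₂ * t ^ α₂ ≤ (C₁ + C₂) * t ^ min α₁ α₂ := by
  obtain ⟨h₁, h₂⟩ := rpow_le_rpow_min (a := α₁) (b := α₂) ht0 ht1
  rw [add_mul]
  exact add_le_add (mul_le_mul_of_nonneg_left h₁ hC₁) (mul_le_mul_of_nonneg_left h₂ hC₂)

/-! ## Sorry-free: the v7 pile-up laws imply the v8 law (nothing of v4–v7 is lost) -/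

/-- **A″ ∧ B″ ⇒ separator law on large boxes.** From the landed pile-up lemma (`stub_sheetPileupOfSingularSeparator`,
p86787: a `τ`-singular separator yields an orthonormal low-mode family of the cell pencil with sheet-weighted pile-up
`> 1/(4τ)`) and the landed census split (`stub_censusDominates`, p86451: `P(separator event) ≤ P(A″) + P(B″)`), the two
v7 laws give the v8 law with `ℓ' = ℓ`, `M₁ = max M₁ᴬ M₁ᴮ`, `R = max Rᴬ Rᴮ`, `S₀ = max S₀ᴬ S₀ᴮ`, `C = Cᴬ + Cᴮ`,
`α = min αᴬ αᴮ`. [folklore] -/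
theorem separatorLawLarge_of_pileupLaws
    (h4 : ∀ (Nf : ℕ) (reg : QCDRegularisation Nf), (Nf = 2 ∨ Nf = 3) → reg.HasMassScaling → (reg.scheme 0 0 0).HasAsymptoticScaling → Filter.Tendsto reg.mcrit Filter.atTop (nhds 0) → ∀ M₀ : ℝ, 0 ≤ M₀ → ∀ b₀ : ℕ, 2 ≤ b₀ → ∀ ℓ : ℝ, 0 < ℓ → (∀ m : Fin Nf → ℝ, (∀ f, M₀ < m f) → ∃ R : ℝ, 0 < R ∧ (∀ ε : ℝ, 0 < ε → ∀ᶠ k : ℕ in Filter.atTop, ∀ S : ℕ, R ≤ reg.a k * (2 * S + 1) → let N : ℕ := 2 * S + 1; let mq : Fin Nf → ℝ := fun f => reg.mcrit k + reg.a k * m f / reg.Zm k; let wt : GaugeConfig 4 N (Matrix.specialUnitaryGroup (Fin 3) ℂ) → ℝ := fun U => ∏ f, ‖fermionDet (wilsonDirac (fundamentalRep (Fin 3)) U (mq f) 1)‖; let P : (GaugeConfig 4 N (Matrix.specialUnitaryGroup (Fin 3) ℂ) → Prop) → ℝ := fun E => (∫ U, (if E U then (1 : ℝ) else 0) * wt U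 ∂(wilsonMeasure (d := 4) (L := N) (fundamentalRep (Fin 3)) (reg.β k))) / (∫ U, wt U ∂(wilsonMeasure (d := 4) (L := N) (fundamentalRep (Fin 3)) (reg.β k))); let J : ℕ := Nat.log 2 (⌊ℓ / reg.a k⌋₊ / b₀) + 1; ∃ δ : ℕ → ℝ, ∑ j ∈ Finset.range J, δ j ≤ ε ∧ ∀ j < J, ∀ s : Fin 4 → ℕ, (∀ i, b₀ * 2 ^ j ≤ s i ∧ s i < b₀ * 2 ^ (j + 2) ∧ s i ≤ N ∧ (s i : ℝ) * reg.a k ≤ ℓ) → P (fun U => ∃ f, IsSignDefect U (mq f) j s) ≤ δ j) ∧ (∀ M : ℝ, M₀ < M → ∀ᶠ k : ℕ in Filter.atTop, ∀ S : ℕ, R ≤ reg.a k * (2 * S + 1) → let N : ℕ := 2 * S + 1; let mq : Fin Nf → ℝ := fun f => reg.mcrit k + reg.a k * m f / reg.Zm k; let wt : GaugeConfig 4 N (Matrix.specialUnitaryGroup (Fin 3) ℂ) → ℝ := fun U => ∏ f, ‖fermionDet (wilsonDirac (fundamentalRep (Fin 3)) U (mq f) 1)‖; (1 / 4 : ℝ)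 ≤ (∫ U, (if (fermionDet (wilsonDirac (fundamentalRep (Fin 3)) U (reg.mcrit k - reg.a k * M / reg.Zm k) 1)).re < 0 then (1 : ℝ) else 0) * wt U ∂(wilsonMeasure (d := 4) (L := N) (fundamentalRep (Fin 3)) (reg.β k))) / (∫ U, wt U ∂(wilsonMeasure (d := 4) (L := N) (fundamentalRep (Fin 3)) (reg.β k))))) → ∃ M₁ : ℝ, M₀ ≤ M₁ ∧ ∀ χ₀ : ℝ, 0 < χ₀ → χ₀ ≤ 1 → ∀ m : Fin Nf → ℝ, (∀ f, M₁ < m f) → ∃ R : ℝ, 0 < R ∧ ∃ S₀ : ℕ, ∃ C : ℝ, 0 < C ∧ ∃ α : ℝ, 0 < α ∧ ∀ᶠ k : ℕ in Filter.atTop, ∀ S : ℕ, R ≤ reg.a k * (2 * S + 1) → let N : ℕ := 2 * S + 1; let mq : Fin Nf → ℝ := fun f => reg.mcrit k + reg.a k * m f / reg.Zm k; let wt : GaugeConfig 4 N (Matrix.specialUnitaryGroup (Fin 3) ℂ) → ℝ := fun U => ∏ f, ‖fermionDet (wilsonDirac (fundamentalRep (Fin 3)) U (mq f) 1)‖; let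 P : (GaugeConfig 4 N (Matrix.specialUnitaryGroup (Fin 3) ℂ) → Prop) → ℝ := fun E => (∫ U, (if E U then (1 : ℝ) else 0) * wt U ∂(wilsonMeasure (d := 4) (L := N) (fundamentalRep (Fin 3)) (reg.β k))) / (∫ U, wt U ∂(wilsonMeasure (d := 4) (L := N) (fundamentalRep (Fin 3)) (reg.β k))); ∀ s : Fin 4 → ℕ, (∀ i, b₀ ≤ s i ∧ s i ≤ N ∧ (s i : ℝ) * reg.a k ≤ ℓ) → (∀ i, S₀ ≤ s i) → (∀ i j, s i ≤ 2 * s j) → ∀ f : Fin Nf, ∀ t : ℝ, 0 < t → t ≤ 1 → P (fun U => ∃ n : ℕ, ∃ u : Fin n → ({p // wilsonBox (0 : TorusSite 4 N) s p} → ℂ), ∃ ev wgt : Fin n → ℝ, (∀ i j, ∑ p, star (u i p) * u j p = if i = j then 1 else 0) ∧ (∀ j, (wilsonCell U (mq f) 0 s).mulVec (u j) = fun p => (ev j : ℂ) * gammaFive p.1.2.2 p.1.2.2 * u j p) ∧ (∀ j, |ev j| < 2 * (t / s 0) ∧ 0 ≤ wgt j ∧ wgt j * |ev j| ≤ 1)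 ∧ (∀ j, χ₀ ≤ ‖∑ p, star (u j p) * gammaFive p.1.2.2 p.1.2.2 * u j p‖) ∧ 1 / (4 * (t / s 0)) < ∑ j, wgt j * ∑ p, if childrenInterior s p then (0 : ℝ) else ‖u j p‖ ^ 2) ≤ C * t ^ α)
    (h5 : ∀ (Nf : ℕ) (reg : QCDRegularisation Nf), (Nf = 2 ∨ Nf = 3) → reg.HasMassScaling → (reg.scheme 0 0 0).HasAsymptoticScaling → Filter.Tendsto reg.mcrit Filter.atTop (nhds 0) → ∀ M₀ : ℝ, 0 ≤ M₀ → ∀ b₀ : ℕ, 2 ≤ b₀ → ∀ ℓ : ℝ, 0 < ℓ → (∀ m : Fin Nf → ℝ, (∀ f, M₀ < m f) → ∃ R : ℝ, 0 < R ∧ (∀ ε : ℝ, 0 < ε → ∀ᶠ k : ℕ in Filter.atTop, ∀ S : ℕ, R ≤ reg.a k * (2 * S + 1) → let N : ℕ := 2 * S + 1; let mq : Fin Nf → ℝ := fun f => reg.mcrit k + reg.a k * m f / reg.Zm k; let wt : GaugeConfig 4 N (Matrix.specialUnitaryGroup (Fin 3) ℂ) → ℝ := fun U => ∏ f, ‖fermionDet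 (wilsonDirac (fundamentalRep (Fin 3)) U (mq f) 1)‖; let P : (GaugeConfig 4 N (Matrix.specialUnitaryGroup (Fin 3) ℂ) → Prop) → ℝ := fun E => (∫ U, (if E U then (1 : ℝ) else 0) * wt U ∂(wilsonMeasure (d := 4) (L := N) (fundamentalRep (Fin 3)) (reg.β k))) / (∫ U, wt U ∂(wilsonMeasure (d := 4) (L := N) (fundamentalRep (Fin 3)) (reg.β k))); let J : ℕ := Nat.log 2 (⌊ℓ / reg.a k⌋₊ / b₀) + 1; ∃ δ : ℕ → ℝ, ∑ j ∈ Finset.range J, δ j ≤ ε ∧ ∀ j < J, ∀ s : Fin 4 → ℕ, (∀ i, b₀ * 2 ^ j ≤ s i ∧ s i < b₀ * 2 ^ (j + 2) ∧ s i ≤ N ∧ (s i : ℝ) * reg.a k ≤ ℓ) → P (fun U => ∃ f, IsSignDefect U (mq f) j s) ≤ δ j) ∧ (∀ M : ℝ, M₀ < M → ∀ᶠ k : ℕ in Filter.atTop, ∀ S : ℕ, R ≤ reg.a k * (2 * S + 1) → let N : ℕ := 2 * S + 1; let mq : Fin Nf → ℝ := fun f => reg.mcrit k + reg.a k * m f /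 reg.Zm k; let wt : GaugeConfig 4 N (Matrix.specialUnitaryGroup (Fin 3) ℂ) → ℝ := fun U => ∏ f, ‖fermionDet (wilsonDirac (fundamentalRep (Fin 3)) U (mq f) 1)‖; (1 / 4 : ℝ) ≤ (∫ U, (if (fermionDet (wilsonDirac (fundamentalRep (Fin 3)) U (reg.mcrit k - reg.a k * M / reg.Zm k) 1)).re < 0 then (1 : ℝ) else 0) * wt U ∂(wilsonMeasure (d := 4) (L := N) (fundamentalRep (Fin 3)) (reg.β k))) / (∫ U, wt U ∂(wilsonMeasure (d := 4) (L := N) (fundamentalRep (Fin 3)) (reg.β k))))) → ∃ M₁ : ℝ, M₀ ≤ M₁ ∧ ∃ χ₀ : ℝ, 0 < χ₀ ∧ χ₀ ≤ 1 ∧ ∀ m : Fin Nf → ℝ, (∀ f, M₁ < m f) → ∃ R : ℝ, 0 < R ∧ ∃ S₀ : ℕ, ∃ C : ℝ, 0 < C ∧ ∃ α : ℝ, 0 < α ∧ ∀ᶠ k : ℕ in Filter.atTop, ∀ S : ℕ, R ≤ reg.a k * (2 * S + 1) → let N : ℕ := 2 * S + 1; let mq : Fin Nf → ℝ := fun f =>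 reg.mcrit k + reg.a k * m f / reg.Zm k; let wt : GaugeConfig 4 N (Matrix.specialUnitaryGroup (Fin 3) ℂ) → ℝ := fun U => ∏ f, ‖fermionDet (wilsonDirac (fundamentalRep (Fin 3)) U (mq f) 1)‖; let P : (GaugeConfig 4 N (Matrix.specialUnitaryGroup (Fin 3) ℂ) → Prop) → ℝ := fun E => (∫ U, (if E U then (1 : ℝ) else 0) * wt U ∂(wilsonMeasure (d := 4) (L := N) (fundamentalRep (Fin 3)) (reg.β k))) / (∫ U, wt U ∂(wilsonMeasure (d := 4) (L := N) (fundamentalRep (Fin 3)) (reg.β k))); ∀ s : Fin 4 → ℕ, (∀ i, b₀ ≤ s i ∧ s i ≤ N ∧ (s i : ℝ) * reg.a k ≤ ℓ) → (∀ i, S₀ ≤ s i) → (∀ i j, s i ≤ 2 * s j) → ∀ f : Fin Nf, ∀ t : ℝ, 0 < t → t ≤ 1 → P (fun U => ∃ n : ℕ, ∃ u : Fin n → ({p // wilsonBox (0 : TorusSite 4 N) s p} → ℂ), ∃ ev wgt : Fin n → ℝ, (∀ i j, ∑ p, star (u i p) * u j p = if i = j then 1 else 0) ∧ (∀ j, (wilsonCell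 U (mq f) 0 s).mulVec (u j) = fun p => (ev j : ℂ) * gammaFive p.1.2.2 p.1.2.2 * u j p) ∧ (∀ j, |ev j| < 2 * (t / s 0) ∧ 0 ≤ wgt j ∧ wgt j * |ev j| ≤ 1) ∧ (∀ j, ‖∑ p, star (u j p) * gammaFive p.1.2.2 p.1.2.2 * u j p‖ < χ₀) ∧ 1 / (4 * (t / s 0)) < ∑ j, wgt j * ∑ p, if childrenInterior s p then (0 : ℝ) else ‖u j p‖ ^ 2) ≤ C * t ^ α) :
    ∀ (Nf : ℕ) (reg : QCDRegularisation Nf), (Nf = 2 ∨ Nf = 3) → reg.HasMassScaling → (reg.scheme 0 0 0).HasAsymptoticScaling → Filter.Tendsto reg.mcrit Filter.atTop (nhds 0) → ∀ M₀ : ℝ, 0 ≤ M₀ → ∀ b₀ : ℕ, 2 ≤ b₀ → ∀ ℓ : ℝ, 0 < ℓ → (∀ m : Fin Nf → ℝ, (∀ f, M₀ < m f) → ∃ R : ℝ, 0 < R ∧ (∀ ε : ℝ, 0 < ε → ∀ᶠ k : ℕ in Filter.atTop, ∀ S : ℕ, R ≤ reg.a k * (2 * S + 1) → let N : ℕ :=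 2 * S + 1; let mq : Fin Nf → ℝ := fun f => reg.mcrit k + reg.a k * m f / reg.Zm k; let wt : GaugeConfig 4 N (Matrix.specialUnitaryGroup (Fin 3) ℂ) → ℝ := fun U => ∏ f, ‖fermionDet (wilsonDirac (fundamentalRep (Fin 3)) U (mq f) 1)‖; let P : (GaugeConfig 4 N (Matrix.specialUnitaryGroup (Fin 3) ℂ) → Prop) → ℝ := fun E => (∫ U, (if E U then (1 : ℝ) else 0) * wt U ∂(wilsonMeasure (d := 4) (L := N) (fundamentalRep (Fin 3)) (reg.β k))) / (∫ U, wt U ∂(wilsonMeasure (d := 4) (L := N) (fundamentalRep (Fin 3)) (reg.β k))); let J : ℕ := Nat.log 2 (⌊ℓ / reg.a k⌋₊ / b₀) + 1; ∃ δ : ℕ → ℝ, ∑ j ∈ Finset.range J, δ j ≤ ε ∧ ∀ j < J, ∀ s : Fin 4 → ℕ, (∀ i, b₀ * 2 ^ j ≤ s i ∧ s i < b₀ * 2 ^ (j + 2) ∧ s i ≤ N ∧ (s i : ℝ) * reg.a k ≤ ℓ) → P (fun U => ∃ f, IsSignDefect U (mq f) j s) ≤ δ j) ∧ (∀ M : ℝ,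 M₀ < M → ∀ᶠ k : ℕ in Filter.atTop, ∀ S : ℕ, R ≤ reg.a k * (2 * S + 1) → let N : ℕ := 2 * S + 1; let mq : Fin Nf → ℝ := fun f => reg.mcrit k + reg.a k * m f / reg.Zm k; let wt : GaugeConfig 4 N (Matrix.specialUnitaryGroup (Fin 3) ℂ) → ℝ := fun U => ∏ f, ‖fermionDet (wilsonDirac (fundamentalRep (Fin 3)) U (mq f) 1)‖; (1 / 4 : ℝ) ≤ (∫ U, (if (fermionDet (wilsonDirac (fundamentalRep (Fin 3)) U (reg.mcrit k - reg.a k * M / reg.Zm k) 1)).re < 0 then (1 : ℝ) else 0) * wt U ∂(wilsonMeasure (d := 4) (L := N) (fundamentalRep (Fin 3)) (reg.β k))) / (∫ U, wt U ∂(wilsonMeasure (d := 4) (L := N) (fundamentalRep (Fin 3)) (reg.β k))))) → ∃ M₁ : ℝ, M₀ ≤ M₁ ∧ ∃ ℓ' : ℝ, 0 < ℓ' ∧ ℓ' ≤ ℓ ∧ ∀ m : Fin Nf → ℝ, (∀ f, M₁ < m f) → ∃ R : ℝ, 0 < R ∧ ∃ S₀ : ℕ, ∃ C : ℝ, 0 <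 C ∧ ∃ α : ℝ, 0 < α ∧ ∀ᶠ k : ℕ in Filter.atTop, ∀ S : ℕ, R ≤ reg.a k * (2 * S + 1) → let N : ℕ := 2 * S + 1; let mq : Fin Nf → ℝ := fun f => reg.mcrit k + reg.a k * m f / reg.Zm k; let wt : GaugeConfig 4 N (Matrix.specialUnitaryGroup (Fin 3) ℂ) → ℝ := fun U => ∏ f, ‖fermionDet (wilsonDirac (fundamentalRep (Fin 3)) U (mq f) 1)‖; let P : (GaugeConfig 4 N (Matrix.specialUnitaryGroup (Fin 3) ℂ) → Prop) → ℝ := fun E => (∫ U, (if E U then (1 : ℝ) else 0) * wt U ∂(wilsonMeasure (d := 4) (L := N) (fundamentalRep (Fin 3)) (reg.β k))) / (∫ U, wt U ∂(wilsonMeasure (d := 4) (L := N) (fundamentalRep (Fin 3)) (reg.β k))); ∀ s : Fin 4 → ℕ, (∀ i, b₀ ≤ s i ∧ s i ≤ N ∧ (s i : ℝ) * reg.a k ≤ ℓ') → (∀ i, S₀ ≤ s i) → (∀ i j, s i ≤ 2 * s j) → ∀ f : Fin Nf, ∀ t : ℝ, 0 < t → t ≤ 1 → P (fun U => HasSingularSeparator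 U (mq f) s (t / s 0)) ≤ C * t ^ α := by
  have h₁ := stub_sheetPileupOfSingularSeparator
  have h₂ := stub_censusDominates
  intro Nf reg hNf hms has hcrit M₀ hM₀ b₀ hb₀ ℓ hℓ hm
  obtain ⟨MA, hMA, hA⟩ := h4 Nf reg hNf hms has hcrit M₀ hM₀ b₀ hb₀ ℓ hℓ hm
  obtain ⟨MB, hMB, χ₀, hχ₀, hχ₁, hB⟩ := h5 Nf reg hNf hms has hcrit M₀ hM₀ b₀ hb₀ ℓ hℓ hm
  refine ⟨max MA MB, le_trans hMA (le_max_left _ _), ℓ, hℓ, le_rfl, fun m hmm => ?_⟩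
  have hmA : ∀ f, MA < m f := fun f => lt_of_le_of_lt (le_max_left _ _) (hmm f)
  have hmB : ∀ f, MB < m f := fun f => lt_of_le_of_lt (le_max_right _ _) (hmm f)
  obtain ⟨RA, hRA, SA, CA, hCA, αA, hαA, hAk⟩ := hA χ₀ hχ₀ hχ₁ m hmA
  obtain ⟨RB, hRB, SB, CB, hCB, αB, hαB, hBk⟩ := hB m hmB
  refine ⟨max RA RB, lt_of_lt_of_le hRA (le_max_left _ _), max SA SB, CA + CB, by positivity,
    min αA αB, lt_min hαA hαB, ?_⟩
  filter_upwards [hAk, hBk] with k hkA hkB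
  intro S hS
  have hA' := hkA S (le_trans (le_max_left _ _) hS)
  have hB' := hkB S (le_trans (le_max_right _ _) hS)
  dsimp only at hA' hB' ⊢
  intro s hs hS₀ hcub f t ht0 ht1
  have h2s : ∀ i, 2 ≤ s i := fun i => le_trans hb₀ (hs i).1
  have hs0 : (0 : ℝ) < (s 0 : ℝ) := by
    exact_mod_cast (lt_of_lt_of_le (by norm_num : (0 : ℕ) < 2) (h2s 0))
  have hτ : 0 < t / (s 0 : ℝ) := div_pos ht0 hs0
  have hlA : ∀ i, SA ≤ s i := fun i => le_trans (le_max_left _ _) (hS₀ i)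
  have hlB : ∀ i, SB ≤ s i := fun i => le_trans (le_max_right _ _) (hS₀ i)
  have hdom := h₂ (2 * S + 1) (reg.β k) Nf (fun f' => reg.mcrit k + reg.a k * m f' / reg.Zm k) s
    (reg.mcrit k + reg.a k * m f / reg.Zm k) (t / (s 0 : ℝ)) χ₀
    (fun U => HasSingularSeparator U (reg.mcrit k + reg.a k * m f / reg.Zm k) s (t / (s 0 : ℝ)))
    (fun U hU => h₁ (2 * S + 1) U s (reg.mcrit k + reg.a k * m f / reg.Zm k) (t / (s 0 : ℝ)) hU hτ)
  have hAt := hA' s hs hlA hcub f t ht0 ht1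
  have hBt := hB' s hs hlB hcub f t ht0 ht1
  exact le_trans hdom (le_trans (add_le_add hAt hBt) (add_powerLaw_le ht0 ht1 hCA.le hCB.le))
/-! ## The composition (PROVED, LANDED p108820): the stubs imply the crux, by name -/

/-- `CoerciveSea` from exactly `stub_pinnedDilutionOnPhysicalBranch` (import) and `stub_separatorLawLarge` (the law), by
the landed composition `coerciveSea_of_pinnedDilutionOnBranch_of_separatorLawLarge`
(`Theorems/NestedDissectionSeaCoerciveSeaWindowShrink.lean`). -/
theorem CoerciveSea_of : Summit.QuantumFields.QCD.Theses.NestedDissectionSea.CoerciveSea :=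
  coerciveSea_of_pinnedDilutionOnBranch_of_separatorLawLarge stub_pinnedDilutionOnPhysicalBranch
    stub_separatorLawLarge

end Summit.QuantumFields.QCD.Cruxes.CoerciveSea.ChiralityCollapsesPseudospectrum

end
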